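import Mathlib.NumberTheory.LSeries.DirichletContinuation
import Mathlib.NumberTheory.LSeries.Nonvanishing
import Mathlib.NumberTheory.Harmonic.GammaDeriv
import HarnessLib

/-!
# The logarithmic derivatives of `L(s, χ)` at `s = 0` and at `s = 1` for an odd primitive character

Topic `Literature/NumberTheory/LFunctions`. THEOREMS (everything proved; no definitions, no named
facts).

For a primitive Dirichlet character `χ` mod `N` with `χ(−1) = −1`, the functional equation
`Λ(χ, 1 − s) = N^{s − ½} ε(χ) Λ(χ⁻¹, s)` (Mathlib
`DirichletCharacter.IsPrimitive.completedLFunction_one_sub`, `Λ(χ, s) = Γ_ℝ(s + 1) L(s, χ)`)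
transfers the logarithmic derivative from `s = 1` to `s = 0`:

  `L'(0, χ)/L(0, χ) + L'(1, χ⁻¹)/L(1, χ⁻¹) = γ + log(2π/N)`     (`logDeriv_LFunction_zero_add_one`),

with Euler's constant `γ`, using `Γ_ℝ'(1)/Γ_ℝ(1) = −(γ + log 4π)/2` (Mathlib
`Complex.hasDerivAt_Gammaℝ_one`) and `Γ_ℝ'(2)/Γ_ℝ(2) = −(γ + log π)/2` (`hasDerivAt_Gammaℝ_two`,
from `Γ'(1) = −γ`). On the way: `L(0, χ) = Λ(χ, 0) = √N ε(χ) Λ(χ⁻¹, 1) ≠ 0`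
(`LFunction_apply_zero_ne_zero`) and `ε(χ) ≠ 0` (`rootNumber_ne_zero`).

Together with `L'(0, χ) = −(log N) L(0, χ) + ∑ χ(a) log Γ(a/N)` (Lerch, `LerchFormula.lean`) this
expresses `L'(1, χ)` of an odd real character through `log Γ` at rational points — the
Dirichlet-series side of the Chowla–Selberg formula (support for the discharge of
`Literature.Analysis.FunctionSpaces.BorweinStraubWanZudilin2012_thm9`).

## References

* H. Davenport, *Multiplicative Number Theory*, 3rd ed., GTM 74, Ch. 9 (functional equation) and
  Ch. 6, (14)–(17) (`L(1, χ)` of real characters).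
* A. Selberg, S. Chowla, On Epstein's zeta-function, J. reine angew. Math. 227 (1967) 86–110, §2.
-/

noncomputable section

open Complex Filter Topology DirichletCharacter
open scoped Real

namespace Literature.NumberTheory.LFunctions

namespace OddCharLogDeriv

variable {N : ℕ} [NeZero N]

/-! ### Odd characters -/

omit [NeZero N] in
/-- An odd character is non-trivial. [folklore] -/
theorem ne_one_of_odd {χ : DirichletCharacter ℂ N} (hodd : χ.Odd) : χ ≠ 1 := by
  intro h
  have h1 : (1 : DirichletCharacter ℂ N) (-1) = 1 :=
    MulChar.one_apply (R' := ℂ) (isUnit_one.neg : IsUnit (-1 : ZMod N))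
  rw [DirichletCharacter.Odd, h, h1] at hodd
  norm_num at hodd

/-- An odd character has level `N ≠ 1`. [folklore] -/
theorem level_ne_one_of_odd {χ : DirichletCharacter ℂ N} (hodd : χ.Odd) : N ≠ 1 := by
  rintro rfl
  have h : (-1 : ZMod 1) = 1 := Subsingleton.elim _ _
  rw [DirichletCharacter.Odd, h, map_one] at hodd
  norm_num at hodd

omit [NeZero N] in
/-- The inverse of an odd character is odd. [folklore] -/
theorem odd_inv {χ : DirichletCharacter ℂ N} (hodd : χ.Odd) : χ⁻¹.Odd := by
  rw [DirichletCharacter.Odd, MulChar.inv_apply_eq_inv', hodd]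
  norm_num

/-- For an odd character, `L(s, χ) = Λ(χ, s)/Γ_ℝ(s + 1)` for all `s`. [folklore] -/
theorem LFunction_eq_completed_div_of_odd {χ : DirichletCharacter ℂ N} (hodd : χ.Odd) (s : ℂ) :
    χ.LFunction s = completedLFunction χ s / Gammaℝ (s + 1) := by
  rw [LFunction_eq_completed_div_gammaFactor χ s (Or.inr (level_ne_one_of_odd hodd)),
    hodd.gammaFactor_def]

/-! ### `Γ_ℝ` at `s = 2` -/

/-- `Γ_ℝ(2) = 1/π`. [folklore] -/
theorem Gammaℝ_two : Gammaℝ 2 = (π : ℂ)⁻¹ := by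
  rw [Gammaℝ_def, show (-(2 : ℂ)) / 2 = -1 by norm_num, show (2 : ℂ) / 2 = 1 by norm_num,
    cpow_neg_one, Complex.Gamma_one, mul_one]

/-- `Γ_ℝ'(2) = −(γ + log π)/(2π)`, i.e. `Γ_ℝ'(2)/Γ_ℝ(2) = −(γ + log π)/2 = ½(ψ(1) − log π)`.
[folklore] -/
theorem hasDerivAt_Gammaℝ_two :
    HasDerivAt Gammaℝ (-((Real.eulerMascheroniConstant : ℂ) + Real.log π) / (2 * π)) 2 := by
  have hπ : (π : ℂ) ≠ 0 := ofReal_ne_zero.mpr Real.pi_ne_zero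
  have hf : HasDerivAt (fun s : ℂ => (π : ℂ) ^ (-s / 2)) (-(Real.log π : ℂ) / (2 * π)) 2 := by
    have h := ((hasDerivAt_neg (2 : ℂ)).div_const 2).const_cpow (c := (π : ℂ)) (Or.inl hπ)
    refine h.congr_deriv ?_
    rw [show (-(2 : ℂ)) / 2 = -1 by norm_num, cpow_neg_one, ← ofReal_log Real.pi_pos.le]
    field_simp
  have hg : HasDerivAt (fun s : ℂ => Complex.Gamma (s / 2))
      (-(Real.eulerMascheroniConstant : ℂ) / 2) 2 := by
    have h2 : HasDerivAt (fun s : ℂ => s / 2) (1 / 2) 2 := (hasDerivAt_id' (2 : ℂ)).div_const 2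
    have hG : HasDerivAt Complex.Gamma (-(Real.eulerMascheroniConstant : ℂ)) ((2 : ℂ) / 2) := by
      rw [show (2 : ℂ) / 2 = 1 by norm_num]
      exact Complex.hasDerivAt_Gamma_one
    refine (HasDerivAt.comp (h := fun s : ℂ => s / 2) 2 hG h2).congr_deriv ?_
    ring
  have he : Gammaℝ = fun s => (π : ℂ) ^ (-s / 2) * Complex.Gamma (s / 2) := funext Gammaℝ_def
  rw [he]
  refine (hf.fun_mul hg).congr_deriv ?_
  rw [show (2 : ℂ) / 2 = 1 by norm_num, Complex.Gamma_one, show (-(2 : ℂ)) / 2 = -1 by norm_num,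
    cpow_neg_one]
  field_simp
  ring

/-! ### The transfer -/

/-- The root number of an odd primitive character is non-zero (indeed of modulus one; only
`≠ 0` is needed here: otherwise the functional equation would force `Λ(χ, 1) = 0`, contradicting
`L(1, χ) ≠ 0`). [folklore] -/
theorem rootNumber_ne_zero {χ : DirichletCharacter ℂ N} (hprim : χ.IsPrimitive) (hodd : χ.Odd) :
    rootNumber χ ≠ 0 := by
  intro h0
  have h1 := hprim.completedLFunction_one_sub 0
  rw [sub_zero, h0, mul_zero, zero_mul] at h1
  have h2 := LFunction_apply_one_ne_zero (ne_one_of_odd hodd)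
  rw [LFunction_eq_completed_div_of_odd hodd 1, h1, zero_div] at h2
  exact h2 rfl

/-- `Λ(χ⁻¹, 1) ≠ 0` for odd `χ` (`= L(1, χ⁻¹)/π`). [folklore] -/
theorem completedLFunction_inv_one_ne_zero {χ : DirichletCharacter ℂ N} (hodd : χ.Odd) :
    completedLFunction χ⁻¹ 1 ≠ 0 := by
  intro h0
  have h2 := LFunction_apply_one_ne_zero (ne_one_of_odd (odd_inv hodd))
  rw [LFunction_eq_completed_div_of_odd (odd_inv hodd) 1, h0, zero_div] at h2
  exact h2 rfl

/-- **`L(0, χ) = Λ(χ, 0) = √N ε(χ) Λ(χ⁻¹, 1)`** for an odd primitive character. [folklore] -/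
theorem LFunction_apply_zero_eq {χ : DirichletCharacter ℂ N} (hprim : χ.IsPrimitive)
    (hodd : χ.Odd) :
    χ.LFunction 0 = (N : ℂ) ^ ((1 : ℂ) - 1 / 2) * rootNumber χ * completedLFunction χ⁻¹ 1 := by
  rw [LFunction_eq_completed_div_of_odd hodd 0, zero_add, Gammaℝ_one, div_one]
  have h := hprim.completedLFunction_one_sub 1
  rwa [sub_self] at h

/-- **`L(0, χ) ≠ 0`** for an odd primitive character (via the functional equation and
`L(1, χ⁻¹) ≠ 0`). [folklore] -/
theorem LFunction_apply_zero_ne_zero {χ : DirichletCharacter ℂ N} (hprim : χ.IsPrimitive)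
    (hodd : χ.Odd) : χ.LFunction 0 ≠ 0 := by
  rw [LFunction_apply_zero_eq hprim hodd]
  have hN0 : (N : ℂ) ≠ 0 := Nat.cast_ne_zero.mpr (NeZero.ne N)
  refine mul_ne_zero (mul_ne_zero ?_ (rootNumber_ne_zero hprim hodd))
    (completedLFunction_inv_one_ne_zero hodd)
  exact fun h => hN0 ((cpow_eq_zero_iff _ _).mp h).1

/-- The functional equation differentiated at `s = 1`:
`−Λ'(χ, 0) = √N ε(χ) (log N · Λ(χ⁻¹, 1) + Λ'(χ⁻¹, 1))`. [folklore] -/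
theorem neg_deriv_completedLFunction_zero {χ : DirichletCharacter ℂ N} (hprim : χ.IsPrimitive)
    (hodd : χ.Odd) :
    -deriv (completedLFunction χ) 0 = (N : ℂ) ^ ((1 : ℂ) - 1 / 2) * rootNumber χ *
      (Complex.log N * completedLFunction χ⁻¹ 1 + deriv (completedLFunction χ⁻¹) 1) := by
  have hN0 : (N : ℂ) ≠ 0 := Nat.cast_ne_zero.mpr (NeZero.ne N)
  have hdΛ : Differentiable ℂ (completedLFunction χ) :=
    differentiable_completedLFunction (ne_one_of_odd hodd)
  have hdΛi : Differentiable ℂ (completedLFunction χ⁻¹) :=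
    differentiable_completedLFunction (ne_one_of_odd (odd_inv hodd))
  -- left-hand side `s ↦ Λ(χ, 1 - s)`
  have h1 : HasDerivAt (fun s : ℂ => completedLFunction χ (1 - s))
      (deriv (completedLFunction χ) 0 * (-1)) 1 := by
    have hin : HasDerivAt (fun s : ℂ => 1 - s) (-1) 1 := by
      simpa using (hasDerivAt_id (1 : ℂ)).const_sub 1
    have hout : HasDerivAt (completedLFunction χ) (deriv (completedLFunction χ) 0)
        ((fun s : ℂ => 1 - s) 1) := by
      rw [show (fun s : ℂ => 1 - s) 1 = 0 by norm_num]
      exact (hdΛ 0).hasDerivAt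
    exact HasDerivAt.comp (h := fun s : ℂ => 1 - s) 1 hout hin
  -- right-hand side
  have hp : HasDerivAt (fun s : ℂ => (N : ℂ) ^ (s - 1 / 2))
      ((N : ℂ) ^ ((1 : ℂ) - 1 / 2) * Complex.log N * 1) 1 :=
    ((hasDerivAt_id' (1 : ℂ)).sub_const (1 / 2)).const_cpow (Or.inl hN0)
  have h2 := (hp.mul_const (rootNumber χ)).fun_mul (hdΛi 1).hasDerivAt
  have heq : (fun s : ℂ => completedLFunction χ (1 - s)) =
      fun s => (N : ℂ) ^ (s - 1 / 2) * rootNumber χ * completedLFunction χ⁻¹ s :=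
    funext fun s => hprim.completedLFunction_one_sub s
  rw [heq] at h1
  have h := h1.unique h2
  rw [show -deriv (completedLFunction χ) 0 = deriv (completedLFunction χ) 0 * -1 by ring, h]
  ring

/-- `L'(0, χ) = Λ'(χ, 0) − Λ(χ, 0) Γ_ℝ'(1)` for odd `χ` (`Γ_ℝ(1) = 1`,
`Γ_ℝ'(1) = −(γ + log 4π)/2`). [folklore] -/
theorem deriv_LFunction_zero_eq {χ : DirichletCharacter ℂ N} (hodd : χ.Odd) :
    deriv χ.LFunction 0 = deriv (completedLFunction χ) 0 -
      completedLFunction χ 0 *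
        (-((Real.eulerMascheroniConstant : ℂ) + Complex.log (4 * π)) / 2) := by
  have hdΛ : Differentiable ℂ (completedLFunction χ) :=
    differentiable_completedLFunction (ne_one_of_odd hodd)
  have hg : HasDerivAt (fun s : ℂ => Gammaℝ (s + 1))
      (-((Real.eulerMascheroniConstant : ℂ) + Complex.log (4 * π)) / 2) 0 := by
    have hin : HasDerivAt (fun s : ℂ => s + 1) 1 0 := (hasDerivAt_id' (0 : ℂ)).add_const 1
    have hout : HasDerivAt Gammaℝ
        (-((Real.eulerMascheroniConstant : ℂ) + Complex.log (4 * π)) / 2)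
        ((fun s : ℂ => s + 1) 0) := by
      rw [show (fun s : ℂ => s + 1) 0 = 1 by norm_num]
      exact Complex.hasDerivAt_Gammaℝ_one
    refine (HasDerivAt.comp (h := fun s : ℂ => s + 1) 0 hout hin).congr_deriv ?_
    rw [mul_one]
  have hq := ((hdΛ 0).hasDerivAt).fun_div hg (by rw [zero_add, Gammaℝ_one]; exact one_ne_zero)
  have heq : χ.LFunction = fun s => completedLFunction χ s / Gammaℝ (s + 1) :=
    funext (LFunction_eq_completed_div_of_odd hodd)
  rw [heq, hq.deriv, zero_add, Gammaℝ_one]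
  ring

/-- `L'(1, χ) = (Λ'(χ, 1) Γ_ℝ(2) − Λ(χ, 1) Γ_ℝ'(2))/Γ_ℝ(2)²` for odd `χ`. [folklore] -/
theorem deriv_LFunction_one_eq {χ : DirichletCharacter ℂ N} (hodd : χ.Odd) :
    deriv χ.LFunction 1 = (deriv (completedLFunction χ) 1 * (π : ℂ)⁻¹ -
      completedLFunction χ 1 *
        (-((Real.eulerMascheroniConstant : ℂ) + Real.log π) / (2 * π))) / ((π : ℂ)⁻¹) ^ 2 := by
  have hπ : (π : ℂ) ≠ 0 := ofReal_ne_zero.mpr Real.pi_ne_zero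
  have hdΛ : Differentiable ℂ (completedLFunction χ) :=
    differentiable_completedLFunction (ne_one_of_odd hodd)
  have hg : HasDerivAt (fun s : ℂ => Gammaℝ (s + 1))
      (-((Real.eulerMascheroniConstant : ℂ) + Real.log π) / (2 * π)) 1 := by
    have hin : HasDerivAt (fun s : ℂ => s + 1) 1 1 := (hasDerivAt_id' (1 : ℂ)).add_const 1
    have hout : HasDerivAt Gammaℝ
        (-((Real.eulerMascheroniConstant : ℂ) + Real.log π) / (2 * π))
        ((fun s : ℂ => s + 1) 1) := by
      rw [show (fun s : ℂ => s + 1) 1 = 2 by norm_num]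
      exact hasDerivAt_Gammaℝ_two
    refine (HasDerivAt.comp (h := fun s : ℂ => s + 1) 1 hout hin).congr_deriv ?_
    rw [mul_one]
  have hq := ((hdΛ 1).hasDerivAt).fun_div hg
    (by rw [one_add_one_eq_two, Gammaℝ_two]; exact inv_ne_zero hπ)
  have heq : χ.LFunction = fun s => completedLFunction χ s / Gammaℝ (s + 1) :=
    funext (LFunction_eq_completed_div_of_odd hodd)
  rw [heq, hq.deriv, one_add_one_eq_two, Gammaℝ_two]

/-- **Transfer of the logarithmic derivative from `s = 1` to `s = 0`.** For a primitive
character `χ` mod `N` with `χ(−1) = −1`,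
`L'(0, χ)/L(0, χ) + L'(1, χ⁻¹)/L(1, χ⁻¹) = γ + log(2π/N)`. [folklore] -/
theorem logDeriv_LFunction_zero_add_one {χ : DirichletCharacter ℂ N} (hprim : χ.IsPrimitive)
    (hodd : χ.Odd) :
    deriv χ.LFunction 0 / χ.LFunction 0 + deriv χ⁻¹.LFunction 1 / χ⁻¹.LFunction 1 =
      (Real.eulerMascheroniConstant : ℂ) + Real.log (2 * π / N) := by
  have hN0 : (N : ℂ) ≠ 0 := Nat.cast_ne_zero.mpr (NeZero.ne N)
  have hNr : (0 : ℝ) < N := Nat.cast_pos.mpr (NeZero.pos N)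
  have hπ : (π : ℂ) ≠ 0 := ofReal_ne_zero.mpr Real.pi_ne_zero
  have hoddi : χ⁻¹.Odd := odd_inv hodd
  have hB : completedLFunction χ⁻¹ 1 ≠ 0 := completedLFunction_inv_one_ne_zero hodd
  have hε : rootNumber χ ≠ 0 := rootNumber_ne_zero hprim hodd
  have hNc : (N : ℂ) ^ ((1 : ℂ) / 2) ≠ 0 := fun h => hN0 ((cpow_eq_zero_iff _ _).mp h).1
  -- substitute everything
  have hA : completedLFunction χ 0 =
      (N : ℂ) ^ ((1 : ℂ) - 1 / 2) * rootNumber χ * completedLFunction χ⁻¹ 1 := by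
    have h := hprim.completedLFunction_one_sub 1
    rwa [sub_self] at h
  have hA' : deriv (completedLFunction χ) 0 = -((N : ℂ) ^ ((1 : ℂ) - 1 / 2) * rootNumber χ *
      (Complex.log N * completedLFunction χ⁻¹ 1 + deriv (completedLFunction χ⁻¹) 1)) := by
    rw [← neg_deriv_completedLFunction_zero hprim hodd, neg_neg]
  have hLi1 : χ⁻¹.LFunction 1 = completedLFunction χ⁻¹ 1 * π := by
    rw [LFunction_eq_completed_div_of_odd hoddi 1, one_add_one_eq_two, Gammaℝ_two,
      div_inv_eq_mul]
  rw [deriv_LFunction_zero_eq hodd, LFunction_apply_zero_eq hprim hodd,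
    deriv_LFunction_one_eq hoddi, hLi1, hA', hA]
  -- real logarithms
  have hl4 : Complex.log (4 * π) = ((2 * Real.log 2 + Real.log π : ℝ) : ℂ) := by
    rw [show (4 * π : ℂ) = ((4 * π : ℝ) : ℂ) by push_cast; ring, ← ofReal_log (by positivity),
      Real.log_mul (by norm_num) Real.pi_ne_zero, show (4 : ℝ) = 2 ^ 2 by norm_num,
      Real.log_pow]
    push_cast
    ring
  have hlN : Complex.log N = ((Real.log N : ℝ) : ℂ) := Complex.natCast_log.symm
  have hl2 : Real.log (2 * π / N) = Real.log 2 + Real.log π - Real.log N := by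
    rw [Real.log_div (by positivity) hNr.ne', Real.log_mul two_ne_zero Real.pi_ne_zero]
  rw [hl4, hlN, hl2, show ((1 : ℂ) - 1 / 2) = 1 / 2 by norm_num]
  push_cast
  field_simp
  ring

end OddCharLogDeriv

end Literature.NumberTheory.LFunctions

end
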